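import Summits.ABC.IUTFork.Cor312SoundInputReindex
import Summits.ABC.IUTFork.Cor312SoundInputPilotTwist
import HarnessLib

/-!
# [IUTchIII] Cor. 3.12 — the canonicity transports COMPOSE: one simultaneous statement, and the
pinned exists-form

Record-only file (D-0012) of the abc-iut cell (D-0067 Cor. 3.12 strategy TEAM C «étale-picture /
multiradiality», seat abc-iut-c312-13, row C-12 of `HOME/plan/C312-TEAMS.md`); TAKES NO SIDE;
proof-only. Rows C-8/C-9/C-10 prove the gap statement of record and each of its two levels invariant
under each C-transport SEPARATELY; the census sentence «the pairwise iffs are generic in the setting,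
so all compositions are one-line» is here made kernel-checked rather than asserted: §1 the THREE
membership-only transports — (Ind3) re-index, Θ-glue (Ind1)(Ind2) twist, étale column transport —
composed in one statement for `SoundAtInput` and for each level separately
(`reindex_twist_recolumn_soundAtInput_iff` / `…_soundAtPilot_iff` / `…_soundOffPilot_iff`; the q-glue
twist composes the same way but carries its row C-7/C-8 volume hypotheses, so it is left to the
generic pairwise iffs). §2 the PINNED exists-form answering w5-d244's N2 note on row C-8 (audit
01:01:33Z, accepted as debt 01:07:40Z): `exists_recolumn_soundAtInput_iff_of_multiradialCompat`
exhibits the transporting `Φ ∈ indGroup` and the column identity `S.D n' = (S.D P.n).map Φ` and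
states the iff AT `P.recolumn n' Φ hD` itself — no abstract `∃ P'` whose relation to `P` is lost.
Consumes rows C-8/C-9/C-10 read-only; no new definitions, no `Prop` facts. Deliberately NOT here:
any claim that `SoundAtInput` or either level holds or fails for an instantiated setting; any
set-level (xi-f) content. Nothing here asserts Cor. 3.12. [claim: Mochizuki2012, status: disputed]
for the quoted clauses; proofs are [folklore] one-line compositions.
-/

noncomputable section

namespace Summit.ABC

namespace IUTFork

namespace Cor312Vol

open Thm311 Cor312 Literature.IUT.LogThetaLattice

variable {T : ThetaIndex} {S : Situation T} (P : Cor312.Setting S)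

/-! ## 1. The three membership-only transports compose into one simultaneous statement -/

/-- **GapA is canonical under the SIMULTANEOUS (Ind3) re-index, Θ-glue (Ind1)(Ind2) twist and étale
column transport** (rows C-9, C-8 §2, C-8 §3 composed; only the two `indGroup` memberships are
hypotheses): the inference of GAP-LEDGER row G-c312-9-1 depends on no representative within the
declared indeterminacies and on no vertical line — simultaneously, not merely one at a time.
[folklore] -/
theorem reindex_twist_recolumn_soundAtInput_iff (G : LinkGluing P) (e : ℤ ≃ ℤ)
    (Φ₀ : S.L.PacketAut) (hΦ₀ : Φ₀ ∈ Setting.indGroup S) (n' : ℤ) (Φ : S.L.PacketAut)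
    (hD : S.D n' = (S.D P.n).map Φ) (hΦ : Φ ∈ Setting.indGroup S) :
    SoundAtInput (((P.reindexGlue e).twistGlue Φ₀).recolumn n' Φ hD)
        (((G.reindex P e).twist (P.reindexGlue e) Φ₀).recolumn
          ((P.reindexGlue e).twistGlue Φ₀) n' Φ hD) ↔
      SoundAtInput P G :=
  (recolumn_soundAtInput_iff ((P.reindexGlue e).twistGlue Φ₀) n' Φ hD
        ((G.reindex P e).twist (P.reindexGlue e) Φ₀) hΦ).trans
    ((twistGlue_soundAtInput_iff (P.reindexGlue e) Φ₀ (G.reindex P e) hΦ₀).trans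
      (reindexGlue_soundAtInput_iff P e G))

/-- **LEVEL 0 under the simultaneous transports** (row C-10's pilot iffs composed). [folklore] -/
theorem reindex_twist_recolumn_soundAtPilot_iff (G : LinkGluing P) (e : ℤ ≃ ℤ)
    (Φ₀ : S.L.PacketAut) (hΦ₀ : Φ₀ ∈ Setting.indGroup S) (n' : ℤ) (Φ : S.L.PacketAut)
    (hD : S.D n' = (S.D P.n).map Φ) (hΦ : Φ ∈ Setting.indGroup S) :
    SoundAtPilot (((P.reindexGlue e).twistGlue Φ₀).recolumn n' Φ hD)
        (((G.reindex P e).twist (P.reindexGlue e) Φ₀).recolumn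
          ((P.reindexGlue e).twistGlue Φ₀) n' Φ hD) ↔
      SoundAtPilot P G :=
  (recolumn_soundAtPilot_iff ((P.reindexGlue e).twistGlue Φ₀) n' Φ hD
        ((G.reindex P e).twist (P.reindexGlue e) Φ₀) hΦ).trans
    ((twistGlue_soundAtPilot_iff (P.reindexGlue e) Φ₀ (G.reindex P e) hΦ₀).trans
      (reindexGlue_soundAtPilot_iff P e G))

/-- **The off-pilot conjunct under the simultaneous transports** (row C-10's off-pilot iffs composed):
the content of GapA beyond the printed Corollary is itself canonical under all three membership-only
re-choices at once. [folklore] -/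
theorem reindex_twist_recolumn_soundOffPilot_iff (G : LinkGluing P) (e : ℤ ≃ ℤ)
    (Φ₀ : S.L.PacketAut) (hΦ₀ : Φ₀ ∈ Setting.indGroup S) (n' : ℤ) (Φ : S.L.PacketAut)
    (hD : S.D n' = (S.D P.n).map Φ) (hΦ : Φ ∈ Setting.indGroup S) :
    SoundOffPilot (((P.reindexGlue e).twistGlue Φ₀).recolumn n' Φ hD)
        (((G.reindex P e).twist (P.reindexGlue e) Φ₀).recolumn
          ((P.reindexGlue e).twistGlue Φ₀) n' Φ hD) ↔
      SoundOffPilot P G :=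
  (recolumn_soundOffPilot_iff ((P.reindexGlue e).twistGlue Φ₀) n' Φ hD
        ((G.reindex P e).twist (P.reindexGlue e) Φ₀) hΦ).trans
    ((twistGlue_soundOffPilot_iff (P.reindexGlue e) Φ₀ (G.reindex P e) hΦ₀).trans
      (reindexGlue_soundOffPilot_iff P e G))

/-! ## 2. The pinned exists-form (w5-d244 N2 on row C-8, discharged) -/

/-- **GapA transports to every column, with the transport EXHIBITED** (repairs the information loss
w5-d244's audit noted in row C-8's `exists_recolumn_soundAtInput_of_multiradialCompat`, whose
`∃ P'` forgot that `P'` is `P`'s own recolumn): under the typed Thm. 3.11 (i) étale-symmetry the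
witness is `P.recolumn n' Φ hD` for an exhibited `Φ ∈ indGroup` with `S.D n' = (S.D P.n).map Φ`, and
the iff holds AT that recolumn. [folklore] -/
theorem exists_recolumn_soundAtInput_iff_of_multiradialCompat (G : LinkGluing P)
    (hMR : S.MultiradialCompat) (n' : ℤ) :
    ∃ (Φ : S.L.PacketAut) (_ : Φ ∈ Setting.indGroup S) (hD : S.D n' = (S.D P.n).map Φ),
      SoundAtInput (P.recolumn n' Φ hD) (G.recolumn P n' Φ hD) ↔ SoundAtInput P G := by
  obtain ⟨Φ, hΦ, hD⟩ := (Situation.multiradialCompat_iff_indGroup S).mp hMR P.n n'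
  have hΦ' : Φ ∈ Setting.indGroup S := hΦ
  exact ⟨Φ, hΦ', hD, recolumn_soundAtInput_iff P n' Φ hD G hΦ'⟩

end Cor312Vol

end IUTFork

end Summit.ABC

end
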